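import Literature.Algebra.EuclideanLattices.SuccessiveMinima
import HarnessLib

/-!
# The successive minima are minima: `λᵢ(L) ≤ r ↔` `i` independent lattice vectors of norm `≤ r`

Trunk: Lattice (T-LATTICE, `Algebra/EuclideanLattices`). Theorems-only companion file of
`Literature/Algebra/EuclideanLattices/SuccessiveMinima.lean`, discharging the named fact
`Literature.Algebra.EuclideanLattices.successiveMinimum_le_iff` by
`Literature.Algebra.EuclideanLattices.successiveMinimum_le_iff_holds`: for a discrete `ℤ`-submodule
`L` of a real normed space `E`, `i ≤ rk_ℝ (span ℝ L)` and `r ≥ 0`,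
`λᵢ(L) ≤ r` if and only if `L` contains `i` `ℝ`-linearly independent vectors of norm at most `r`.
(Kept separate from `SuccessiveMinimaProofs.lean`, `SuccessiveMinimaPositivity.lean`,
`SuccessiveMinimaMinNormPos.lean`, …, which discharge the other facts of the same file; this file
imports only `SuccessiveMinima.lean`.)

## Source

Peikert, *A Decade of Lattice Cryptography*, Found. Trends Theor. Comput. Sci. 10(4) (2016),
§2.2.1 "Basic Definitions" (pp. 6–7 of the author's version): "An `n`-dimensional lattice `L` is
any subset of `ℝⁿ` that is both: 1. an additive subgroup […]; and 2. discrete: every `x ∈ L` has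
a neighborhood in `ℝⁿ` in which `x` is the only lattice point. […] The minimum distance of a
lattice `L` is the length of a shortest nonzero lattice vector: `λ₁(L) := min_{v ∈ L∖{0}} ‖v‖`.
[…] More generally, the `i`th successive minimum `λᵢ(L)` is the smallest `r` such that `L` has
`i` linearly independent vectors of norm at most `r`." (The definitions are unnumbered prose;
full rank is imposed only later in §2.2.1, "For the remainder of this survey we restrict our
attention to full-rank lattices".) The same notion, for the distance function of a bounded star
body, is Cassels, *An Introduction to the Geometry of Numbers*, Ch. VIII §1 (p. 201), with the
attainment of the `λ_k` in §1.2, Lemma 1 (pp. 203–204: the set `F(x) < λₙ + 1` "contains only a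
finite number of lattice points").

The vendored definition `Literature.Algebra.EuclideanLattices.successiveMinimum L i` is the
*infimum* of the radii `r ≥ 0` such that `span ℝ (L ∩ closedBall 0 r)` has `finrank ≥ i`; the fact
`successiveMinimum_le_iff` says that, for a discrete `L` and `i` at most the rank, this infimum is
Peikert's *minimum*: the property "`L` has `i` linearly independent vectors of norm `≤ r`" is
upward closed in `r` and holds at `r = λᵢ(L)`, which is exactly `λᵢ(L) ≤ r ↔ (property at r)`.
The statement is faithful to the source (no discrepancy found); Peikert's ambient `ℝⁿ` is replaced
by any real normed space, the hypothesis `i ≤ finrank ℝ (span ℝ L)` playing the role of `i ≤ n`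
(it excludes the junk value `0` of the infimum of the empty set).

## Proof architecture

Write `d(ρ) := finrank ℝ (span ℝ (L ∩ closedBall 0 ρ))` and `S := {ρ ≥ 0 | i ≤ d(ρ)}`, so that
`λᵢ(L) = inf S`. The case `i = 0` is trivial (`λ₀ = 0 ≤ r`, empty family). For `i ≥ 1` the
hypothesis `i ≤ finrank ℝ (span ℝ L)` forces `V := span ℝ L` to be finite-dimensional
(`Module.finite_of_finrank_pos`), hence every `span ℝ (L ∩ closedBall 0 ρ) ≤ V` is, and `d` is
monotone (`Submodule.finrank_mono`).
* *Membership criterion* (`le_finrank_span_inter_closedBall_iff`): `i ≤ d(ρ)` iff `L` has `i`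
  linearly independent vectors of norm `≤ ρ` — from a spanning set one extracts `finrank` linearly
  independent members (`exists_fun_fin_finrank_span_eq`), and conversely `i` independent vectors
  span an `i`-dimensional subspace (`finrank_span_eq_card`). This gives `←` at once
  (`r ∈ S`, `inf S ≤ r`) and shows `S ≠ ∅` (apply the extraction to `L` itself, `i ≤ finrank V`,
  and take a ball containing the `i` vectors; Cassels's remark `λ_k ≤ max_j F(a_j)`, p. 202).
* *Attainment* (`→`, Peikert's "smallest", Cassels's Lemma 1): let `s := inf S ≤ r`. Every `ρ > s`
  lies in `S` (some `σ ∈ S` has `σ < ρ`, and `d` is monotone). The lattice vectors of norm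
  `≤ s + 1` form a finite set (`finite_inter_closedBall_of_finite_span`: `L` is closed and discrete
  in `E`, so its trace on the proper space `V` meets the compact ball of `V` in a finite set —
  `Metric.finite_isBounded_inter_isClosed`; this is Peikert's discreteness axiom 2 at work), so
  some `ρ ∈ (s, s + 1)` lies strictly below the norm of each of the finitely many lattice vectors
  `x` with `s < ‖x‖ ≤ s + 1` (a finite intersection of neighbourhoods of `s`,
  `Set.Finite.eventually_all`, meets `(s, ∞)`). Then `L ∩ closedBall 0 ρ ⊆ closedBall 0 s`, whence
  `i ≤ d(ρ) ≤ d(s) ≤ d(r)`, and the criterion at `r` yields the vectors.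

## References

* C. Peikert, *A Decade of Lattice Cryptography*, Foundations and Trends in Theoretical Computer
  Science 10(4), 283–424 (2016), §2.2.1 [PeikertDecade2016].
* J. W. S. Cassels, *An Introduction to the Geometry of Numbers*, Classics in Mathematics,
  Springer (1997), Ch. VIII §1 (pp. 201–202) and §1.2 Lemma 1 (pp. 203–204) [Cassels1997].
-/

noncomputable section

open Module Metric Filter
open scoped _root_.Topology

namespace Literature.Algebra.EuclideanLattices

variable {E : Type*} [NormedAddCommGroup E] [NormedSpace ℝ E]

/-- A discrete subgroup `L` of a real normed space whose `ℝ`-span `V` is finite-dimensional meets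
every closed ball in finitely many points: `L` is closed in `E` (a discrete subgroup of a
Hausdorff group, `AddSubgroup.isClosed_of_discrete`) and discrete, hence so is its trace on the
proper space `V`, which therefore meets the compact closed ball of `V` in a finite set
(`Metric.finite_isBounded_inter_isClosed`); and `L ∩ closedBall 0 r` is the image of that set.
(Without finite-dimensionality of the span this fails: `⊕ₙ ℤeₙ ⊆ ℓ²` is discrete with all `eₙ` in
the unit ball.) Cassels, Ch. III §1.2 Lemma 1 (ii) / Ch. VIII §1.2 ("contains only a finite number
of lattice points", p. 204); Peikert's discreteness axiom, §2.2.1. [folklore] -/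
theorem finite_inter_closedBall_of_finite_span (L : Submodule ℤ E) [DiscreteTopology L]
    [FiniteDimensional ℝ (Submodule.span ℝ (L : Set E))] (r : ℝ) :
    ((L : Set E) ∩ closedBall (0 : E) r).Finite := by
  -- `L` is closed in `E`
  have hclosed : IsClosed (X := E) L := @AddSubgroup.isClosed_of_discrete _ _ _ _ _
    L.toAddSubgroup (inferInstanceAs (DiscreteTopology L))
  -- its trace on the finite-dimensional (hence proper) subspace `V := span ℝ L` is discrete …
  have hdisc : DiscreteTopology
      ((Subtype.val : Submodule.span ℝ (L : Set E) → E) ⁻¹' (L : Set E)) :=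
    @DiscreteTopology.preimage_of_continuous_injective _ _ _ _ (L : Set E)
      (inferInstanceAs (DiscreteTopology L)) _ continuous_subtype_val Subtype.val_injective
  -- … and closed, so it meets the (compact) closed ball of radius `r` of `V` in a finite set
  have hfin : (closedBall (0 : Submodule.span ℝ (L : Set E)) r ∩
      ((Subtype.val : Submodule.span ℝ (L : Set E) → E) ⁻¹' (L : Set E))).Finite :=
    Metric.finite_isBounded_inter_isClosed (isDiscrete_iff_discreteTopology.2 hdisc)
      isBounded_closedBall (hclosed.preimage continuous_subtype_val)
  -- `L ∩ closedBall 0 r` is the image of that finite set under the inclusion `V → E`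
  refine (hfin.image Subtype.val).subset ?_
  rintro x ⟨hxL, hxr⟩
  refine ⟨⟨x, Submodule.subset_span hxL⟩, ⟨?_, hxL⟩, rfl⟩
  rw [mem_closedBall_zero_iff] at hxr ⊢
  exact hxr

/-- From a set `t` spanning a finite-dimensional subspace of dimension `≥ i` one extracts `i`
linearly independent members of `t` (`exists_fun_fin_finrank_span_eq` composed with
`Fin.castLE`). [folklore] -/
theorem exists_linearIndependent_mem_of_le_finrank_span {t : Set E}
    [Module.Finite ℝ (Submodule.span ℝ t)] {i : ℕ} (hi : i ≤ finrank ℝ (Submodule.span ℝ t)) :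
    ∃ v : Fin i → E, LinearIndependent ℝ v ∧ ∀ k, v k ∈ t := by
  obtain ⟨f, hft, -, hf⟩ := Submodule.exists_fun_fin_finrank_span_eq ℝ t
  exact ⟨f ∘ Fin.castLE hi, hf.comp _ (Fin.castLE_injective hi), fun k => hft _⟩

/-- For every `ℤ`-submodule `L` of a real normed space, the span of the lattice vectors of norm
`≤ ρ` is a subspace of `span ℝ L`, hence finite-dimensional when the latter is. [folklore] -/
theorem finite_span_inter_closedBall (L : Submodule ℤ E)
    [Module.Finite ℝ (Submodule.span ℝ (L : Set E))] (ρ : ℝ) :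
    Module.Finite ℝ (Submodule.span ℝ ((L : Set E) ∩ closedBall (0 : E) ρ)) :=
  Submodule.finiteDimensional_of_le (Submodule.span_mono Set.inter_subset_left)

/-- Membership criterion for the set of radii defining `λᵢ(L)`: when
`span ℝ (L ∩ closedBall 0 ρ)` is finite-dimensional, it has `finrank ≥ i` iff `L` contains `i`
`ℝ`-linearly independent vectors of norm `≤ ρ` (`→`: extract `i` independent members of the
spanning set; `←`: `i` independent vectors span an `i`-dimensional subspace,
`finrank_span_eq_card`). [folklore] -/
theorem le_finrank_span_inter_closedBall_iff (L : Submodule ℤ E) {i : ℕ} {ρ : ℝ}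
    [Module.Finite ℝ (Submodule.span ℝ ((L : Set E) ∩ closedBall (0 : E) ρ))] :
    i ≤ finrank ℝ (Submodule.span ℝ ((L : Set E) ∩ closedBall (0 : E) ρ)) ↔
      ∃ v : Fin i → E, LinearIndependent ℝ v ∧ ∀ k, v k ∈ L ∧ ‖v k‖ ≤ ρ := by
  constructor
  · intro h
    obtain ⟨v, hv, hvt⟩ := exists_linearIndependent_mem_of_le_finrank_span h
    exact ⟨v, hv, fun k => ⟨(hvt k).1, mem_closedBall_zero_iff.1 (hvt k).2⟩⟩
  · rintro ⟨v, hv, hvL⟩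
    calc i = finrank ℝ (Submodule.span ℝ (Set.range v)) := by
          rw [finrank_span_eq_card hv, Fintype.card_fin]
      _ ≤ _ := Submodule.finrank_mono (Submodule.span_mono (Set.range_subset_iff.2 fun k =>
          Set.mem_inter (hvL k).1 (mem_closedBall_zero_iff.2 (hvL k).2)))

/-- Discharge of `successiveMinimum_le_iff` (**Peikert 2016, §2.2.1**: "the `i`th successive
minimum `λᵢ(L)` is the smallest `r` such that `L` has `i` linearly independent vectors of norm at
most `r`", for a lattice = discrete additive subgroup; Cassels, Ch. VIII §1 and §1.2 Lemma 1):
for a discrete `ℤ`-submodule `L` of a real normed space, `i ≤ finrank ℝ (span ℝ L)` and `0 ≤ r`,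
`successiveMinimum L i ≤ r ↔ ∃ v : Fin i → E`, `ℝ`-linearly independent, with `v k ∈ L` and
`‖v k‖ ≤ r`. Proof: for `i = 0` both sides hold. For `i ≥ 1`, `span ℝ L` is finite-dimensional;
with `d(ρ) := finrank (span ℝ (L ∩ closedBall 0 ρ))` (monotone) and `S := {ρ ≥ 0 | i ≤ d(ρ)}`,
`λᵢ(L) = inf S`, `S ≠ ∅` (`i` independent lattice vectors fit in a ball) and `ρ ∈ S` iff `L` has
`i` independent vectors of norm `≤ ρ` (`le_finrank_span_inter_closedBall_iff`). `←`: `r ∈ S`.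
`→`: with `s := inf S ≤ r`, every `ρ > s` is in `S`; the lattice vectors of norm `≤ s + 1` being
finitely many (`finite_inter_closedBall_of_finite_span`), some `ρ ∈ (s, s + 1)` lies below the
norm of each lattice vector `x` with `‖x‖ > s`, `‖x‖ ≤ s + 1`, so
`L ∩ closedBall 0 ρ ⊆ closedBall 0 s` and `i ≤ d(ρ) ≤ d(s) ≤ d(r)`; conclude by the criterion at
`r`. [cite: PeikertDecade2016, §2.2.1] -/
theorem successiveMinimum_le_iff_holds : successiveMinimum_le_iff (E := E) := by
  intro L _ i hi' r hr
  -- `i = 0`: both sides hold (`λ₀(L) = 0 ≤ r`, the empty family)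
  rcases Nat.eq_zero_or_pos i with rfl | hi0
  · rw [successiveMinimum_zero]
    exact iff_of_true hr ⟨fun k => k.elim0, linearIndependent_empty_type, fun k => k.elim0⟩
  -- `i ≥ 1`: `span ℝ L` has positive `finrank`, hence is finite-dimensional, and so is every
  -- `span ℝ (L ∩ closedBall 0 ρ)`; the dimension of the latter is monotone in `ρ`
  have hV : Module.Finite ℝ (Submodule.span ℝ (L : Set E)) :=
    Module.finite_of_finrank_pos (hi0.trans_le hi')
  have hfin : ∀ ρ : ℝ,
      Module.Finite ℝ (Submodule.span ℝ ((L : Set E) ∩ closedBall (0 : E) ρ)) :=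
    finite_span_inter_closedBall L
  have hmono : ∀ {ρ σ : ℝ}, ρ ≤ σ →
      finrank ℝ (Submodule.span ℝ ((L : Set E) ∩ closedBall (0 : E) ρ)) ≤
        finrank ℝ (Submodule.span ℝ ((L : Set E) ∩ closedBall (0 : E) σ)) := fun h =>
    Submodule.finrank_mono (Submodule.span_mono
      (Set.inter_subset_inter_right _ (closedBall_subset_closedBall h)))
  -- the set `S` of admissible radii is nonempty: `i` independent lattice vectors fit in a ball
  have hne : {ρ : ℝ | 0 ≤ ρ ∧
      i ≤ finrank ℝ (Submodule.span ℝ ((L : Set E) ∩ closedBall (0 : E) ρ))}.Nonempty := by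
    obtain ⟨w, hw, hwL⟩ := exists_linearIndependent_mem_of_le_finrank_span hi'
    obtain ⟨R, hR⟩ := Finite.exists_le fun k => ‖w k‖
    exact ⟨max R 0, le_max_right _ _, (le_finrank_span_inter_closedBall_iff L).2
      ⟨w, hw, fun k => ⟨hwL k, (hR k).trans (le_max_left _ _)⟩⟩⟩
  unfold successiveMinimum
  rw [← le_finrank_span_inter_closedBall_iff L]
  refine ⟨fun h => ?_, fun h => csInf_le ⟨0, fun _ hρ => hρ.1⟩ ⟨hr, h⟩⟩
  -- `→`: the infimum `s := inf S ≤ r` is attained. First, every `ρ > s` is admissible.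
  have hgt : ∀ ρ : ℝ, sInf {ρ : ℝ | 0 ≤ ρ ∧
      i ≤ finrank ℝ (Submodule.span ℝ ((L : Set E) ∩ closedBall (0 : E) ρ))} < ρ →
        i ≤ finrank ℝ (Submodule.span ℝ ((L : Set E) ∩ closedBall (0 : E) ρ)) := by
    intro ρ hρ
    obtain ⟨σ, hσ, hσρ⟩ := exists_lt_of_csInf_lt hne hρ
    exact hσ.2.trans (hmono hσρ.le)
  generalize sInf {ρ : ℝ | 0 ≤ ρ ∧
    i ≤ finrank ℝ (Submodule.span ℝ ((L : Set E) ∩ closedBall (0 : E) ρ))} = s at h hgt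
  -- the lattice vectors `x` with `s < ‖x‖ ≤ s + 1` are finitely many …
  have hG : ({x : E | x ∈ L ∧ s < ‖x‖} ∩ closedBall (0 : E) (s + 1)).Finite :=
    (finite_inter_closedBall_of_finite_span L (s + 1)).subset
      (Set.inter_subset_inter_left _ fun x hx => hx.1)
  -- … so some `ρ ∈ (s, s + 1)` lies strictly below all their norms
  obtain ⟨ρ, hsρ, hρG, hρ1⟩ : ∃ ρ : ℝ, s < ρ ∧
      (∀ x ∈ {x : E | x ∈ L ∧ s < ‖x‖} ∩ closedBall (0 : E) (s + 1), ρ < ‖x‖) ∧ ρ < s + 1 := by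
    have h1 : ∀ᶠ ρ : ℝ in 𝓝 s,
        ∀ x ∈ {x : E | x ∈ L ∧ s < ‖x‖} ∩ closedBall (0 : E) (s + 1), ρ < ‖x‖ :=
      hG.eventually_all.2 fun x hx => eventually_lt_nhds hx.1.2
    have h2 : ∀ᶠ ρ : ℝ in 𝓝 s, ρ < s + 1 := eventually_lt_nhds (lt_add_one s)
    have h3 : ∀ᶠ ρ : ℝ in 𝓝[>] s, s < ρ := eventually_mem_nhdsWithin
    exact (h3.and ((h1.and h2).filter_mono nhdsWithin_le_nhds)).exists
  -- hence `L ∩ closedBall 0 ρ ⊆ closedBall 0 s`, and `s` itself is admissible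
  have hsub : (L : Set E) ∩ closedBall (0 : E) ρ ⊆ (L : Set E) ∩ closedBall (0 : E) s := by
    rintro x ⟨hxL, hxρ⟩
    rw [mem_closedBall_zero_iff] at hxρ
    refine ⟨hxL, mem_closedBall_zero_iff.2 (not_lt.1 fun hsx => ?_)⟩
    exact (hρG x ⟨⟨hxL, hsx⟩, mem_closedBall_zero_iff.2 (hxρ.trans hρ1.le)⟩).not_ge hxρ
  exact ((hgt ρ hsρ).trans (Submodule.finrank_mono (Submodule.span_mono hsub))).trans (hmono h)

end Literature.Algebra.EuclideanLattices
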